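import Summits.BirchSwinnertonDyer.BirchSwinnertonDyer.Theorems.GenusKolyvaginAtTwoPowDvdShaCardAtTwoRTRelaxedSelmerGenusBudget
import Literature.NumberTheory.EllipticCurves.NonvanishingTwistsWaldspurgerOfHoffsteinLuo
import Literature.NumberTheory.EllipticCurves.ModularityVersionApProofs
import Literature.NumberTheory.EllipticCurves.PAdicGrossZagierConstantTermProofs
import HarnessLib

/-!
# Route `GenusKolyvaginAtTwo`, LINE 18 / LINE 19 (L_T stmt-BirchSwinnertonDyer-23242, L⁺_T stmt-23379): the GENUS BUDGET for the
# Heegner field with the skeletons' binders VERBATIM — `IsImaginaryQuadratic K`, `Odd (discr K)`,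
# `SatisfiesHeegnerHypothesis (W.conductorNorm ℤ) K` — and in the DEF currency `∏_{p ∣ d_K} (#{roots of ψ mod p} + 1)`

Seat `bsd-line-gk2-p3` g17 (cell `bsd-f1-sign2`), `--supports stmt-BirchSwinnertonDyer-23242` (helper; closes nothing).
THEOREMS ONLY (no definition, no named fact, no `sorry`); BSD is not proved by any of this.

`relIndex_selmerGroup_relaxed_le_prod_natCard_twoTorsion` (sibling file `…RTRelaxedSelmerGenusBudget`) bounds the index of
`Sel^(n)(E/ℚ)` in the `d_K`-relaxed Selmer group `res⁻¹(Sel^(n)(E_K/K)) ⊓ ⨅_∞` by `∏_{p ∣ d_K} #E(ℚ_p)[2]`, granted good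
reduction at the non-split primes off `d_K`.  Under the Heegner hypothesis every prime of bad reduction SPLITS in `K`
(`SatisfiesHeegnerHypothesis N K`: `#{𝔭 ∣ p} = 2` for `p ∣ N`), so that hypothesis is automatic
(`hasGoodReductionAt_primePlace_of_ncard_ne_two`), and moreover every `p ∣ d_K` is a prime of GOOD reduction, where gk2-p5's
Hensel count reads `#E(ℚ_p)[2] = #{x̄ ∈ 𝔽_p : ψ(x̄) = 0} + 1 = #Ẽ(𝔽_p)[2]` (`GenusKolyTwin.natCard_twoTorsion_padic_eq`):

* `relIndex_selmerGroup_relaxed_le_prod_natCard_twoTorsion_of_heegner` — **`[Sel^rel : Sel^(n)(E/ℚ)] ≤ ∏_{p ∣ d_K} #E(ℚ_p)[2]`**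
  for `W/ℚ` elliptic, `K` imaginary quadratic with odd `d_K` satisfying the Heegner hypothesis for `N_W`;
* `relIndex_selmerGroup_relaxed_le_prod_ncard_roots_add_one_of_heegner` — the same bound as
  **`∏_{p ∣ d_K} (#{x̄ ∈ 𝔽_p : 4x̄³ + b₂x̄² + 2b₄x̄ + b₆ = 0} + 1) = 2^{Σ_{p ∣ d_K} i_p}`** for `W` globally minimal — the finite
  part of the instrument law `e_an = Σ_{v ∣ d_K ∞} i_v − 1` of the pen's kit j318164 / j318378 as an UPPER BOUND on the
  relaxed-vs-strict index, for every level `n`.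

References: [Kramer1981] §2 Prop. 3, Thm. 1; [GrossLMS1991] §1 (Heegner hypothesis); [MazurRubin2010] Lemma 2.2 (i), Prop. 3.3;
[SilvermanAEC2009] VII.3.1(b), VII.5.1(a); [DiamondShurman2005] §8.3.
-/

set_option autoImplicit false
-- the Theorems namespace of this sub repeats the summit name by design (D-0017 nested layout)
set_option linter.dupNamespace false

noncomputable section

open scoped Classical

namespace Summit.BirchSwinnertonDyer.BirchSwinnertonDyer.Theorems.GenusExact.PlusDescent

open WeierstrassCurve NumberField IsDedekindDomain Rat.HeightOneSpectrum Literature.NumberTheory.EllipticCurves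
  Literature.Barriers.BirchSwinnertonDyer

variable (W : WeierstrassCurve ℚ) [W.IsElliptic] (K : Type) [Field K] [NumberField K]

omit [NumberField K] in
/-- **Under the Heegner hypothesis a non-split prime is a prime of good reduction**: if every `p ∣ N_W` splits in `K` then at a
prime `p` with `#{𝔭 ∣ p} ≠ 2` one has `p ∤ N_W`, i.e. good reduction at the place of `p` (`f_p = 0 ⟺` good reduction, tree
`hasGoodReductionAt_of_not_dvd_conductorNorm`). [cite: GrossLMS1991, §1] [cite: DiamondShurman2005, §8.3 (PDF p. 353)] -/
theorem hasGoodReductionAt_primePlace_of_ncard_ne_two (hHe : SatisfiesHeegnerHypothesis (W.conductorNorm ℤ) K) {p : ℕ}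
    (hp : p.Prime) (hns : ((Ideal.span {(p : ℤ)}).primesOver (𝓞 K)).ncard ≠ 2) :
    W.HasGoodReductionAt (Matsuno2009.primePlace p) := by
  refine hasGoodReductionAt_of_not_dvd_conductorNorm W (Matsuno2009.primePlace p) ?_
  rw [Matsuno2009.primesEquiv_primePlace hp]
  exact fun h ↦ hns (hHe p hp h)

/-- **Under the Heegner hypothesis a ramified prime `p ∣ d_K` (odd `d_K`) is a prime of good reduction**, hence `p ∤ Δ_min(W)`
for `W` globally minimal (`ncard_primesOver_ne_two_of_dvd_discr`, `hasGoodReductionAt_primePlace_of_ncard_ne_two`,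
`not_dvd_minimalDiscriminantInt_of_hasGoodReductionAtPrime`). [cite: GrossLMS1991, §1] [cite: SilvermanAEC2009, VII.5 Prop. 5.1(a)] -/
theorem not_dvd_minimalDiscriminantInt_of_dvd_discr_of_heegner [W.IsGloballyMinimal] (h2 : Module.finrank ℚ K = 2)
    (hHe : SatisfiesHeegnerHypothesis (W.conductorNorm ℤ) K) {p : ℕ} (hp : p.Prime) (hp2 : p ≠ 2)
    (hpd : (p : ℤ) ∣ NumberField.discr K) : ¬ (p : ℤ) ∣ minimalDiscriminantInt W := by
  haveI := Fact.mk hp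
  refine W.not_dvd_minimalDiscriminantInt_of_hasGoodReductionAtPrime p ?_
  by_contra hbad
  exact ncard_primesOver_ne_two_of_dvd_discr h2 hp hp2 hpd
    (hHe p hp ((W.dvd_conductorNorm_iff_not_hasGoodReductionAtPrime p).mpr hbad))

/-- **THE GENUS BUDGET FOR THE HEEGNER FIELD** (critic #179 price (1), binders of the LINE 18/19 skeletons verbatim): `W/ℚ`
elliptic, `K` imaginary quadratic with `d_K` odd and the Heegner hypothesis for `N_W`; then for every level `n` the `d_K`-relaxed
Selmer group `res⁻¹(Sel^(n)(W_K/K)) ⊓ ⨅_∞(ℝ-condition)` contains `Sel^(n)(W/ℚ)` (`selmerGroup_le_relaxed`) with index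
`≤ ∏_{p ∣ d_K} #E(ℚ_p)[2]`. [cite: Kramer1981, §2 Prop. 3 and Thm. 1] [cite: MazurRubin2010, Prop. 3.3] -/
theorem relIndex_selmerGroup_relaxed_le_prod_natCard_twoTorsion_of_heegner (hIQ : IsImaginaryQuadratic K)
    (hodd : Odd (NumberField.discr K)) (hHe : SatisfiesHeegnerHypothesis (W.conductorNorm ℤ) K) (n : ℤ) :
    (selmerGroup W n).relIndex ((selmerGroup (W.baseChange K) n).comap (resTorsion W K n) ⊓
        ⨅ w : InfinitePlace ℚ, selmerLocalKer W w.Completion n) ≤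
      ∏ p ∈ (NumberField.discr K).natAbs.primeFactors,
        Nat.card {P : (W.baseChange ((Matsuno2009.primePlace p).adicCompletion ℚ)).toAffine.Point // 2 • P = 0} :=
  relIndex_selmerGroup_relaxed_le_prod_natCard_twoTorsion W K n hIQ.1 hodd
    fun _ hp _ hns ↦ hasGoodReductionAt_primePlace_of_ncard_ne_two W K hHe hp hns

/-- **THE GENUS BUDGET IN THE DEF CURRENCY: `[Sel^rel : Sel^(n)(W/ℚ)] ≤ ∏_{p ∣ d_K} (#{roots of ψ mod p} + 1)`**
(`= ∏ #Ẽ(𝔽_p)[2] = 2^{Σ_{p ∣ d_K} i_p}`) for `W/ℚ` globally minimal elliptic and `K` imaginary quadratic with odd `d_K`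
satisfying the Heegner hypothesis for `N_W`: each `p ∣ d_K` is an odd prime of good reduction
(`not_dvd_minimalDiscriminantInt_of_dvd_discr_of_heegner`), where `#E(ℚ_p)[2] = #{x̄ : ψ(x̄) = 0} + 1`
(`natCard_twoTorsion_adicCompletion_eq_padic`, gk2-p5's `GenusKolyTwin.natCard_twoTorsion_padic_eq`).  This is the finite part of
the pen's instrument law `e_an = Σ_{v ∣ d_K∞} i_v − 1` (kit j318164 / j318378) as an upper bound, for every level `n`.
[cite: Kramer1981, §2 Prop. 3 and Thm. 1] [cite: MazurRubin2010, Lemma 2.2 (i)] [cite: SilvermanAEC2009, VII.3 Prop. 3.1(b)] -/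
theorem relIndex_selmerGroup_relaxed_le_prod_ncard_roots_add_one_of_heegner [W.IsGloballyMinimal]
    (hIQ : IsImaginaryQuadratic K) (hodd : Odd (NumberField.discr K))
    (hHe : SatisfiesHeegnerHypothesis (W.conductorNorm ℤ) K) (n : ℤ) :
    (selmerGroup W n).relIndex ((selmerGroup (W.baseChange K) n).comap (resTorsion W K n) ⊓
        ⨅ w : InfinitePlace ℚ, selmerLocalKer W w.Completion n) ≤
      ∏ p ∈ (NumberField.discr K).natAbs.primeFactors,
        ({x : ZMod p | 4 * x ^ 3 + ((integralModelInt W).b₂ : ZMod p) * x ^ 2 +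
          2 * ((integralModelInt W).b₄ : ZMod p) * x + ((integralModelInt W).b₆ : ZMod p) = 0}.ncard + 1) := by
  refine (relIndex_selmerGroup_relaxed_le_prod_natCard_twoTorsion_of_heegner W K hIQ hodd hHe n).trans_eq
    (Finset.prod_congr rfl fun p hp ↦ ?_)
  have hD0 : (NumberField.discr K).natAbs ≠ 0 := Int.natAbs_ne_zero.mpr (NumberField.discr_ne_zero K)
  obtain ⟨hpr, hpdvd, -⟩ := Nat.mem_primeFactors.mp hp
  have hpd : (p : ℤ) ∣ NumberField.discr K := Int.natCast_dvd.mpr hpdvd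
  have hp2 : p ≠ 2 := by
    rintro rfl
    obtain ⟨r, hr⟩ := hodd
    omega
  haveI := Fact.mk hpr
  rw [natCard_twoTorsion_adicCompletion_eq_padic W (Matsuno2009.primePlace p) (Matsuno2009.natCast_mem_primePlace hpr)]
  exact GenusKolyTwin.natCard_twoTorsion_padic_eq W hp2
    (not_dvd_minimalDiscriminantInt_of_dvd_discr_of_heegner W K hIQ.1 hHe hpr hp2 hpd)

end Summit.BirchSwinnertonDyer.BirchSwinnertonDyer.Theorems.GenusExact.PlusDescent

end
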